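import Summits.QuantumFields.YangMills.Theorems.UnitScaleTiltProp7CombFrameRem2TopFderivT3
import Summits.QuantumFields.YangMills.Theorems.UnitScaleTiltProp7CombFrameLinearResponseOfRegPrT3
import HarnessLib

/-!
# Route `UnitScaleTilt`, crux K1 «MinimiserStabilityRegPr» (stmt-QuantumFields-19200), route-R E′ (A′)-on-Σ, P-A2 (β), R0 ∕ REM2ᶜ — file F-γᶜ3c «REM2ᶜ AT THE Σ∕E2E DATUM, `ℓ := fderiv`,
# KINEMATICS DISCHARGED»: **`Σ_{y : Site (F.P n) 0} ‖w_{iX}(y) − 1 − D(w_{·}(y))(0)[iX]‖ ≤ 2L·(477L²·Am + 3L·Am₂ + 49·220L³·Am)·ℓ⁻¹ + (477L²·Bm + 3L·Bm₂ + 49·110L²·Bm)·ℓ`**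
# UNDER EXACTLY the two admitted route-internal rows `hMcomb` (SIGNATURE-0 2f7f2fca) and `hMcomb₂` (SIGNATURE-0′ 53b55878) — the comb twin of ✓px13 `Prop7FrameRem2OfRegPrT3`

Cell `ym3-torus` (HUMAN RULING D-0037: YM₃ on the torus is ladder rung R3 — not d = 4, not a mass gap, not Clay), width seat `ym3-torus-px17` (gen 4); ★★OWNER RULINGS №19 (3) ∕ №20 (1).
`--supports stmt-QuantumFields-19200 --as helper`; THEOREMS ONLY (0 `def`, 0 `sorry`); count-neutral.  «route-internal rows (n3)-comb ∕ (n3)-comb₂ — NOT N06, NOT print rows; OPEN; RULINGS №19 O4 ∕ №20 (1)».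
Nothing of `hMcomb`, `hMcomb₂`, (β), `hPA2`, `hcoS`, E′, EX, the crux, d = 4 or the gap is claimed.

THE POINT.  F-γᶜ3b (✓`Prop7CombFrameRem2TopFderivT3.sum_norm_frameTw_sub_one_sub_fderiv_le_of_hMcomb₂`) displays, besides `hMcomb`∕`hMcomb₂`, the kinematic rows `hT`∕`hF`: differentiability at
`A′ = 0` of the single bars `A′ ↦ ↑(Ũ₁ˡ[(e^{A′})♯](x, κ))` and of the accumulated frames `A′ ↦ ↑(v_l[(e^{A′})♯](x))` of print's comb tower over the pulled-back background `W♯ = pull (bgUnits W) x₀`,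
every `l < K − n`.  At the member (`RegPr F n K ε₀ W`, `10⁷L⁴ε₀ ≤ 1` hence `10⁷L³ε₀ ≤ 1`) both are ★routeR-w2 g9's (2ᶜ) ✓`Prop7CombFrameLinearResponseOfRegPr.differentiableAt_coe_tildIter_of_regPr` ∕
✓`differentiableAt_coe_vcov_of_regPr` ([Balaban1985Averaging] Prop. 4 p.38 ∕ Prop. 6 p.43 analyticity at a general small background, lit ✓`B7Prop6GeneralAnalytic`), so they drop: the consumer
(px16 g5's G3 `hRc_of_hMcomb_hMcomb₂`) reads REM2ᶜ modulo `hMcomb` ⊕ `hMcomb₂` ALONE.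

WHAT IS PROVED (ns `…Theorems.Prop7CombFrameRem2OfRegPrT3`): `window_ten7_cube_of_four` (`10⁷L⁴ε₀ ≤ 1 → 10⁷L³ε₀ ≤ 1`), ★★★ `sum_norm_frameTw_sub_one_sub_fderiv_le_of_regPr` (the title).
HONEST SCOPE.  One `exact` over F-γᶜ3b and ★routeR-w2's (2ᶜ); the analytic content is the displayed `hMcomb` (XL) + `hMcomb₂` (L); nothing of print asserted; rung R3, not Clay; YM gap NOT proved.

References: T. Bałaban, CMP **98** (1985) 17–51 [Balaban1985Averaging] ((58) p.27, (82) p.30, (97) p.32, (111) p.34, Prop. 3 (122)–(126) p.36, Prop. 4 p.38, Prop. 6 p.43); CMP **99** (1985)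
389–434 [Balaban1985BackgroundPropagators] ((3.14) p.393); CMP **102** (1985) 277–309 [Balaban1985Variational] ((44) p.285); CMP **109** (1987) 249–301 [Balaban1987RG1] ((0.3)–(0.4) pp.252–253).
-/

set_option autoImplicit false

noncomputable section

open scoped BigOperators Matrix.Norms.L2Operator

namespace Summit.QuantumFields.YangMills.Theorems.Prop7CombFrameRem2OfRegPrT3

open Finset NormedSpace
open Literature.MathematicalPhysics.QuantumFieldTheory.Balaban1983to89
open Literature.MathematicalPhysics.QuantumFieldTheory.Balaban1983to89.T3ContinuumYM3Torus
open T4Continuum BlockAveraging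
open T3PrintedRegularMinimiser (RegPr)
open T3SectALandauChart (bgUnits)
open B7Prop1Explicit renaming Site → LSite
open B7Prop1Explicit (expUnit)
open B7Eq92Concrete (tildIter vcov)
open B10Eq27TorusAxialLog (pull)
open Summit.QuantumFields.YangMills.Theorems.Prop7SPrint (basePt)
open Summit.QuantumFields.YangMills.Theorems.Prop7TPrint (nMax19)
open Summit.QuantumFields.YangMills.Theorems.Prop7SymAvgTw (frameTw)
open Summit.QuantumFields.YangMills.Theorems.Prop7CombFrameRem2TopFderivT3 (sum_norm_frameTw_sub_one_sub_fderiv_le_of_hMcomb₂)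
open Summit.QuantumFields.YangMills.Theorems.Prop7CombFrameLinearResponseOfRegPr (differentiableAt_coe_tildIter_of_regPr differentiableAt_coe_vcov_of_regPr)

section Member

variable (F : T3Family) {n K : ℕ} (h : n ≤ K)

/-- The comb window of ★routeR-w2's (2ᶜ) (`10⁷L³ε₀ ≤ 1`, ✓`Prop7FrameResponseCombSU2.windows_of_ten7`) from the REM2ᶜ window `10⁷L⁴ε₀ ≤ 1` (`L ≥ 3` for a `T3Family`).
[cite: Balaban1985Averaging, (52) p.26] -/
theorem window_ten7_cube_of_four {ε₀ : ℝ} (hε₀ : 0 ≤ ε₀) (hε : 10 ^ 7 * (F.L : ℝ) ^ 4 * ε₀ ≤ 1) : 10 ^ 7 * (F.L : ℝ) ^ 3 * ε₀ ≤ 1 := by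
  have hL3 : (3 : ℝ) ≤ F.L := by
    have h3 : 3 ≤ F.L := by obtain ⟨a, ha⟩ := F.hL.1; have := F.hL.2; omega
    exact_mod_cast h3
  have h34 : (F.L : ℝ) ^ 3 ≤ (F.L : ℝ) ^ 4 := pow_le_pow_right₀ (by linarith) (by norm_num)
  exact (mul_le_mul_of_nonneg_right (mul_le_mul_of_nonneg_left h34 (by norm_num)) hε₀).trans hε

/-- ★★★ **REM2ᶜ AT THE Σ∕E2E DATUM WITH THE FRÉCHET DERIVATIVE AS THE LINEAR PART, KINEMATICS DISCHARGED** (R0-DOOR's `hrc` summed; px16 g5's `hRc` supplier): member `(F, n ≤ K)`,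
`W ∈ 𝔘_k(ε₀)` (`10⁷L⁴ε₀ ≤ 1`), Hermitian traceless `X` of (19)-size `nMax19 W X < ε₀∕6`; DISPLAYED: ONLY `hMcomb` and `hMcomb₂`, TOKEN FOR TOKEN at `A := iX` (free reals `Am Bm Am₂ Bm₂ ≥ 0`).  THEN
`Σ_{y : Site (F.P n) 0} ‖↑(frameTw W (iX) y) − 1 − fderiv ℂ (A′ ↦ ↑(frameTw W A′ y)) 0 (iX)‖ ≤ 2L·(477L²·Am + 3L·Am₂ + 49·(220L³·Am))·(L^{K−n})⁻¹ + (477L²·Bm + 3L·Bm₂ + 49·(110L²·Bm))·L^{K−n}`.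
The rows `hT`∕`hF` of F-γᶜ3b are ★routeR-w2's ✓`differentiableAt_coe_tildIter_of_regPr` ∕ ✓`differentiableAt_coe_vcov_of_regPr` at every `l < K − n`.
[cite: Balaban1985Averaging, (82) p.30, (97) p.32, (111) p.34, Prop. 3 (122)-(126) p.36, Prop. 4 p.38, Prop. 6 p.43; Balaban1985BackgroundPropagators, (3.14) p.393; Balaban1985Variational, (44) p.285] -/
theorem sum_norm_frameTw_sub_one_sub_fderiv_le_of_regPr {ε₀ : ℝ} (hε₀ : 0 < ε₀) (hε : 10 ^ 7 * (F.L : ℝ) ^ 4 * ε₀ ≤ 1)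
    (W : GaugeField (F.P K) 0 (Matrix.specialUnitaryGroup (Fin 2) ℂ)) (hreg : RegPr F n K ε₀ W)
    (X : PBond (F.P K) 0 → Matrix (Fin 2) (Fin 2) ℂ) (hX : ∀ b, (X b).IsHermitian ∧ (X b).trace = 0) (hX6 : nMax19 F n K W X < ε₀ / 6)
    {Am Bm Am₂ Bm₂ : ℝ} (hAm : 0 ≤ Am) (hBm : 0 ≤ Bm) (hAm₂ : 0 ≤ Am₂) (hBm₂ : 0 ≤ Bm₂)
    (hMcomb : ∀ l : ℕ, l < K - n →
      ∑ z : Site (F.P K) l, ∑ κ : Fin (F.P K).d,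
        ‖((tildIter (F.P K).L (pull (bgUnits F K W) (basePt F n K)) (pull (fun b => expUnit (Complex.I • X b)) (basePt F n K)) l
              (fun μ => ((z μ).val : ℤ)) κ : (Matrix (Fin 2) (Fin 2) ℂ)ˣ) : Matrix (Fin 2) (Fin 2) ℂ) - 1‖ ^ 2
          ≤ Am * ((F.L : ℝ) ^ l)⁻¹ + Bm * (F.L : ℝ) ^ l)
    (hMcomb₂ : ∀ l : ℕ, l < K - n →
      ∑ z : Site (F.P K) l, ∑ κ : Fin (F.P K).d,
        ‖((tildIter (F.P K).L (pull (bgUnits F K W) (basePt F n K)) (pull (fun b => expUnit ((fun b => Complex.I • X b) b)) (basePt F n K)) l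
              (fun μ => ((z μ).val : ℤ)) κ : (Matrix (Fin 2) (Fin 2) ℂ)ˣ) : Matrix (Fin 2) (Fin 2) ℂ) - 1
            - (fderiv ℂ (fun A' : PBond (F.P K) 0 → Matrix (Fin 2) (Fin 2) ℂ =>
                ((tildIter (F.P K).L (pull (bgUnits F K W) (basePt F n K)) (pull (fun b => expUnit (A' b)) (basePt F n K)) l (fun μ => ((z μ).val : ℤ)) κ :
                  (Matrix (Fin 2) (Fin 2) ℂ)ˣ) : Matrix (Fin 2) (Fin 2) ℂ)) 0) (fun b => Complex.I • X b)‖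
          ≤ Am₂ * ((F.L : ℝ) ^ l)⁻¹ + Bm₂ * (F.L : ℝ) ^ l) :
    ∑ y : Site (F.P n) 0, ‖((frameTw F n K h W (fun b => Complex.I • X b) y : (Matrix (Fin 2) (Fin 2) ℂ)ˣ) : Matrix (Fin 2) (Fin 2) ℂ) - 1
        - fderiv ℂ (fun A' : PBond (F.P K) 0 → Matrix (Fin 2) (Fin 2) ℂ => ((frameTw F n K h W A' y : (Matrix (Fin 2) (Fin 2) ℂ)ˣ) : Matrix (Fin 2) (Fin 2) ℂ)) 0
            (fun b => Complex.I • X b)‖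
      ≤ 2 * (F.L : ℝ) * (477 * (F.L : ℝ) ^ 2 * Am + 3 * (F.L : ℝ) * Am₂ + 49 * (220 * (F.L : ℝ) ^ 3 * Am)) * ((F.L : ℝ) ^ (K - n))⁻¹
        + (477 * (F.L : ℝ) ^ 2 * Bm + 3 * (F.L : ℝ) * Bm₂ + 49 * (110 * (F.L : ℝ) ^ 2 * Bm)) * (F.L : ℝ) ^ (K - n) := by
  have hε3 : 10 ^ 7 * (F.L : ℝ) ^ 3 * ε₀ ≤ 1 := window_ten7_cube_of_four F hε₀.le hε
  exact sum_norm_frameTw_sub_one_sub_fderiv_le_of_hMcomb₂ F h hε₀ hε W hreg X hX hX6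
    (fun l hl x κ => differentiableAt_coe_tildIter_of_regPr hε₀ hε3 W hreg hl.le x κ)
    (fun l hl x => differentiableAt_coe_vcov_of_regPr hε₀ hε3 W hreg hl.le x)
    hAm hBm hAm₂ hBm₂ hMcomb hMcomb₂

end Member

end Summit.QuantumFields.YangMills.Theorems.Prop7CombFrameRem2OfRegPrT3

end
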